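import Summits.ValiantsHypothesis.ValiantsHypothesis.Theorems.BarrierLeverGradientGenericFibreCountCounting

/-!
# Route BarrierLever — item `GradientGenericFibreCount` (stmt-ValiantsHypothesis-19256),
# part 3/6: Hilbert series of a graded complete intersection (`e^k`) and the assembly of the item
# from the two stubs `MReg`, `GenericRadical`

`hilb`, `hilbSeries` (Hilbert function / series of a homogeneous ideal), `hilbSeries_sup_span`
(dividing by a homogeneous non-zero-divisor of degree `e` multiplies the series by `1 - X^e`),
`prefixIdeal`, `hilb_count` and `finrank_quotient_eq_pow`: for `k ≥ 1` forms `H_i` of degree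
`e ≥ 1` in `k` variables forming a regular sequence with Koszul syzygies, and `F = H + lower`,
`K[x]/(F)` is finite-dimensional of dimension EXACTLY `e^k` (affine Bézout equality). Then the
ASSEMBLY: the two remaining inputs are stated as the Props `MReg` (Macaulay: forms with only the
trivial common zero form a regular sequence; proved in part 4) and `GenericRadical` (some fibre
`(F - c)` is radical; proved in part 6), and `item19256_of : MReg → GenericRadical → <item 19256
verbatim>` via the tree's zero-dimensional finiteness theorem
(`finrank_eq_ncard_zeroLocus_iff_isRadical`).

Lean text authored by the cell planner seat `valiant-natproofs-p2` (gen 4, HOME/HBasis-p2g4.lean,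
1431 lines, kernel-checked rc 0 / 0 sorries; referee REF-G12 §4 and REF-G13 §2 PASS incl. full
line-read), ported by the prover seat (namespace `…Theorems.BarrierLever.HBasis`, six files, split
only). Stated over a general field `K` where the scratch does.

WHAT THIS IS NOT: nothing here touches FSV Question 6 / crux stmt-14610 or `VP` vs `VNP`; the item
is the algebro-geometric half of `NaturalProofsAgainstAllLinearSizes` (stmt-20156), whose
complexity half is `NaturalProofsAgainstAllLinearSizesOfCount` (stmt-19261).

References: Macaulay 1916 (H-bases); [CoxLittleOSheaUsing2005] Ch. 3 Thm. (5.5); Hartshorne III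
Cor. 10.7 (generic smoothness, replaced here by the Jacobian/Kähler argument); tree files
`Koszul.RegularSequenceFirstHomology`, `ZeroDimensional.FinitenessTheorem`, `RegularLocalRing.SopRegular`.
-/

-- layout Summits/ValiantsHypothesis/ValiantsHypothesis forces the duplicated namespace component
set_option linter.dupNamespace false

open MvPolynomial Finset

namespace Summit.ValiantsHypothesis.ValiantsHypothesis.Theorems.BarrierLever.HBasis

variable {K : Type*} [Field K] {σ : Type*} {ι : Type*} [Fintype ι]

/-! ## Hilbert series of a graded complete intersection: `Σ_t H((H₁,…,H_k); t) = e^k` -/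

section Hilbert

attribute [local instance] MvPolynomial.gradedAlgebra

open Module PowerSeries Literature.RingTheory.MvPolynomial

/-- The Hilbert function `t ↦ dim S_t − dim I_t`. -/
noncomputable def hilb [Finite σ] (I : Ideal (MvPolynomial σ K)) (t : ℕ) : ℕ :=
  finrank K (homogeneousSubmodule σ K t) - finrank K (idealDegree I t)

/-- Its generating series in `ℤ⟦X⟧`. -/
noncomputable def hilbSeries [Finite σ] (I : Ideal (MvPolynomial σ K)) : PowerSeries ℤ :=
  PowerSeries.mk fun t => (hilb I t : ℤ)

/-- Below the degree of `Q`, adjoining `Q` does not change the graded pieces. -/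
theorem idealDegree_sup_span_singleton_of_lt {I : Ideal (MvPolynomial σ K)}
    (hI : I.IsHomogeneous (homogeneousSubmodule σ K)) {Q : MvPolynomial σ K} {q : ℕ}
    (hQ : Q.IsHomogeneous q) {t : ℕ} (ht : t < q) :
    idealDegree (I ⊔ Ideal.span {Q}) t = idealDegree I t := by
  apply le_antisymm _ (idealDegree_mono le_sup_left _)
  rintro f ⟨hf, hft⟩
  obtain ⟨i, hi, j, hj, rfl⟩ := Submodule.mem_sup.mp hf
  obtain ⟨r, rfl⟩ := Ideal.mem_span_singleton'.mp hj
  refine ⟨?_, hft⟩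
  have h := homogeneousComponent_eq_self (show (i + r * Q).IsHomogeneous t from hft)
  rw [map_add, homogeneousComponent_mul_eq_zero_of_lt hQ ht, add_zero] at h
  rw [← h]
  exact MvPolynomial.homogeneousComponent_mem_of_mem hI hi t

/-- **Hilbert series under a homogeneous non-zero-divisor**:
`HS(I + (Q)) = (1 − X^q) · HS(I)`. -/
theorem hilbSeries_sup_span [Finite σ] {I : Ideal (MvPolynomial σ K)}
    (hI : I.IsHomogeneous (homogeneousSubmodule σ K)) {Q : MvPolynomial σ K} (hQ0 : Q ≠ 0)
    {q : ℕ} (hQ : Q.IsHomogeneous q) (hnzd : ∀ f, Q * f ∈ I → f ∈ I) :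
    hilbSeries (I ⊔ Ideal.span {Q}) = (1 - PowerSeries.X ^ q) * hilbSeries I := by
  ext n
  rw [sub_mul, one_mul, map_sub, coeff_X_pow_mul']
  simp only [hilbSeries, coeff_mk]
  split_ifs with h
  · obtain ⟨t, rfl⟩ := Nat.exists_eq_add_of_le' h
    have := hilbert_sup_span_add_hilbert_eq hI hQ0 hQ hnzd t
    rw [Nat.add_sub_cancel]
    unfold hilb
    omega
  · simp only [hilb, sub_zero]
    rw [idealDegree_sup_span_singleton_of_lt hI hQ (by omega)]

/-- `HS(S) · (1 − X)^{d+1} = 1` for `S = K[x_0, …, x_d]`. -/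
theorem hilbSeries_bot_mul (d : ℕ) :
    hilbSeries (⊥ : Ideal (MvPolynomial (Fin (d + 1)) K)) * (1 - PowerSeries.X) ^ (d + 1) = 1 := by
  have h : hilbSeries (⊥ : Ideal (MvPolynomial (Fin (d + 1)) K)) =
      PowerSeries.mk fun n => ((Nat.choose (d + n) d : ℕ) : ℤ) := by
    ext n
    simp only [hilbSeries, coeff_mk, hilb]
    rw [finrank_homogeneousSubmodule_sub_finrank_idealDegree_bot]
    congr 1
    rw [show n + (d + 1) - 1 = n + d by omega, Nat.choose_symm_add, add_comm]
  rw [h]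
  exact mk_add_choose_mul_one_sub_pow_eq_one (S := ℤ) (d := d)

/-- The ideal `(H_0, …, H_{j-1})` of a prefix of the sequence. -/
noncomputable def prefixIdeal {n : ℕ} (H : Fin n → MvPolynomial σ K) (j : ℕ) :
    Ideal (MvPolynomial σ K) :=
  Ideal.span {x | ∃ i : Fin n, (i : ℕ) < j ∧ H i = x}

/-- The empty prefix ideal is `⊥`. -/
theorem prefixIdeal_zero {n : ℕ} (H : Fin n → MvPolynomial σ K) : prefixIdeal H 0 = ⊥ := by
  rw [prefixIdeal, Ideal.span_eq_bot]
  rintro x ⟨i, hi, rfl⟩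
  omega

/-- `prefixIdeal H (j+1) = prefixIdeal H j ⊔ (H j)`. -/
theorem prefixIdeal_succ {n : ℕ} (H : Fin n → MvPolynomial σ K) {j : ℕ} (hj : j < n) :
    prefixIdeal H (j + 1) = prefixIdeal H j ⊔ Ideal.span {H ⟨j, hj⟩} := by
  rw [prefixIdeal, prefixIdeal, ← Ideal.span_union]
  congr 1
  ext x
  constructor
  · rintro ⟨i, hi, rfl⟩
    rcases Nat.lt_succ_iff_lt_or_eq.1 hi with h | h
    · exact Or.inl ⟨i, h, rfl⟩
    · right
      rw [Set.mem_singleton_iff]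
      congr 1
      exact Fin.ext h
  · rintro (⟨i, hi, rfl⟩ | hx)
    · exact ⟨i, by omega, rfl⟩
    · rw [Set.mem_singleton_iff] at hx
      exact ⟨⟨j, hj⟩, by simp, hx.symm⟩

/-- The full prefix ideal is the ideal of all the `H i`. -/
theorem prefixIdeal_top {n : ℕ} (H : Fin n → MvPolynomial σ K) :
    prefixIdeal H n = Ideal.span (Set.range H) := by
  rw [prefixIdeal]
  congr 1
  ext x
  constructor
  · rintro ⟨i, -, rfl⟩; exact ⟨i, rfl⟩
  · rintro ⟨i, rfl⟩; exact ⟨i, i.2, rfl⟩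

/-- Prefix ideals of forms are homogeneous ideals. -/
theorem prefixIdeal_isHomogeneous {n e : ℕ} (H : Fin n → MvPolynomial σ K)
    (hH : ∀ i, (H i).IsHomogeneous e) (j : ℕ) :
    (prefixIdeal H j).IsHomogeneous (homogeneousSubmodule σ K) :=
  Ideal.homogeneous_span _ _ (by rintro x ⟨i, -, rfl⟩; exact ⟨e, hH i⟩)

/-- `HS((H_0, …, H_{j-1})) · (1 − X)^{d+1} = (1 − X^e)^j` for a sequence of forms of degree `e`
each of which is a non-zero-divisor modulo its predecessors. -/
theorem hilbSeries_prefix_mul {d n e : ℕ} (H : Fin n → MvPolynomial (Fin (d + 1)) K)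
    (hH : ∀ i, (H i).IsHomogeneous e) (hH0 : ∀ i, H i ≠ 0)
    (hnzd : ∀ j : Fin n, ∀ f, H j * f ∈ prefixIdeal H j → f ∈ prefixIdeal H j) :
    ∀ j, j ≤ n → hilbSeries (prefixIdeal H j) * (1 - PowerSeries.X) ^ (d + 1) =
      (1 - PowerSeries.X ^ e) ^ j := by
  intro j
  induction j with
  | zero => intro _; rw [prefixIdeal_zero, pow_zero]; exact hilbSeries_bot_mul d
  | succ j ih =>
    intro hj
    have hj' : j < n := hj
    rw [prefixIdeal_succ H hj',
      hilbSeries_sup_span (prefixIdeal_isHomogeneous H hH j) (hH0 _) (hH _) (hnzd ⟨j, hj'⟩),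
      mul_assoc, ih hj'.le, pow_succ, mul_comm]

/-- **Bezout count for a graded complete intersection** (memo §4b, M-Hilb): for `k` forms
`H_0, …, H_{k-1}` of degree `e ≥ 1` in `k` variables, each a non-zero-divisor modulo its
predecessors, `H((H); t) = 0` for `t > k(e−1)` and `Σ_{t ≤ T} H((H); t) = e^k` (`T ≥ k(e−1)`). -/
theorem hilb_count {k e : ℕ} (hk : 1 ≤ k) (H : Fin k → MvPolynomial (Fin k) K)
    (hH : ∀ i, (H i).IsHomogeneous e) (hH0 : ∀ i, H i ≠ 0)
    (hnzd : ∀ j : Fin k, ∀ f, H j * f ∈ prefixIdeal H j → f ∈ prefixIdeal H j) :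
    (∀ t, k * (e - 1) < t → hilb (Ideal.span (Set.range H)) t = 0) ∧
    ∀ T, k * (e - 1) ≤ T →
      ∑ t ∈ Finset.range (T + 1), hilb (Ideal.span (Set.range H)) t = e ^ k := by
  obtain ⟨d, rfl⟩ : ∃ d, k = d + 1 := ⟨k - 1, by omega⟩
  have hmul := hilbSeries_prefix_mul H hH hH0 hnzd (d + 1) le_rfl
  rw [prefixIdeal_top] at hmul
  -- the polynomial `(Σ_{i<e} X^i)^(d+1)`
  set P : Polynomial ℤ := (∑ i ∈ Finset.range e, Polynomial.X ^ i) ^ (d + 1) with hPdef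
  have hPcoe : (P : PowerSeries ℤ) = (∑ i ∈ Finset.range e, (PowerSeries.X : PowerSeries ℤ) ^ i) ^ (d + 1) := by
    change Polynomial.coeToPowerSeries.ringHom P = _
    simp only [hPdef, map_pow, map_sum, Polynomial.coeToPowerSeries.ringHom_apply,
      Polynomial.coe_X]
  have h1X : (1 - PowerSeries.X : PowerSeries ℤ) ≠ 0 := by
    intro h0
    have := congrArg (PowerSeries.constantCoeff (R := ℤ)) h0
    simp at this
  have hPJ : hilbSeries (Ideal.span (Set.range H)) = (P : PowerSeries ℤ) := by
    have hgeom : (∑ i ∈ Finset.range e, (PowerSeries.X : PowerSeries ℤ) ^ i) *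
        (1 - PowerSeries.X) = 1 - PowerSeries.X ^ e :=
      geom_sum_mul_neg PowerSeries.X e
    apply mul_right_cancel₀ (pow_ne_zero (d + 1) h1X)
    rw [hmul, hPcoe, ← mul_pow, hgeom]
  have hnat : P.natDegree ≤ (d + 1) * (e - 1) := by
    rw [hPdef]
    refine Polynomial.natDegree_pow_le.trans (Nat.mul_le_mul_left _ ?_)
    refine Polynomial.natDegree_sum_le_of_forall_le _ _ fun i hi => ?_
    rw [Polynomial.natDegree_X_pow]
    have := Finset.mem_range.1 hi
    omega
  have hcoeff : ∀ t, (hilb (Ideal.span (Set.range H)) t : ℤ) = P.coeff t := by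
    intro t
    have := congrArg (coeff (R := ℤ) t) hPJ
    simpa [hilbSeries, coeff_mk, Polynomial.coeff_coe] using this
  refine ⟨fun t ht => ?_, fun T hT => ?_⟩
  · have h := hcoeff t
    rw [Polynomial.coeff_eq_zero_of_natDegree_lt (by omega)] at h
    exact_mod_cast h
  · have heval : P.eval 1 = (e : ℤ) ^ (d + 1) := by
      rw [hPdef, Polynomial.eval_pow, Polynomial.eval_geom_sum]
      simp
    have hsum : P.eval 1 = ∑ t ∈ Finset.range (T + 1), P.coeff t := by
      rw [Polynomial.eval_eq_sum_range' (by omega : P.natDegree < T + 1)]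
      simp
    have : (∑ t ∈ Finset.range (T + 1), (hilb (Ideal.span (Set.range H)) t : ℤ)) =
        (e : ℤ) ^ (d + 1) := by
      rw [← heval, hsum]
      exact Finset.sum_congr rfl fun t _ => hcoeff t
    exact_mod_cast this

/-- **`dim S/(F) = e^k`** (memo §4b, M-Hbasis + M-Hilb combined): `F_i = H_i + (deg < e)`, the
`H_i` being `k` forms of degree `e ≥ 1` in `k` variables forming a (weakly) regular sequence in the
prefix non-zero-divisor sense, with vanishing first Koszul homology. In particular the value is the
same for `F − c`, every `c ∈ K^k`. -/
theorem finrank_quotient_eq_pow {k e : ℕ} (hk : 1 ≤ k) (he : 1 ≤ e)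
    (H F : Fin k → MvPolynomial (Fin k) K)
    (hH : ∀ i, (H i).IsHomogeneous e) (hF : ∀ i, (F i - H i).totalDegree < e)
    (hH0 : ∀ i, H i ≠ 0)
    (hnzd : ∀ j : Fin k, ∀ f, H j * f ∈ prefixIdeal H j → f ∈ prefixIdeal H j)
    (hK : Literature.RingTheory.Koszul.HasKoszulSyzygies H) :
    Module.Finite K (MvPolynomial (Fin k) K ⧸ Ideal.span (Set.range F)) ∧
      finrank K (MvPolynomial (Fin k) K ⧸ Ideal.span (Set.range F)) = e ^ k := by
  obtain ⟨hzero, hsum⟩ := hilb_count hk H hH hH0 hnzd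
  have htop : ∀ t, k * (e - 1) < t → ∀ m : MvPolynomial (Fin k) K, m.IsHomogeneous t →
      m ∈ Ideal.span (Set.range H) := by
    intro t ht m hm
    haveI := finite_homogeneousSubmodule (K := K) (σ := Fin k) t
    have hle : idealDegree (Ideal.span (Set.range H)) t ≤ homogeneousSubmodule (Fin k) K t :=
      inf_le_right
    have hfin : finrank K (idealDegree (Ideal.span (Set.range H)) t) =
        finrank K (homogeneousSubmodule (Fin k) K t) := by
      have h1 := hzero t ht
      have h2 := finrank_idealDegree_le (Ideal.span (Set.range H)) t
      simp only [hilb] at h1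
      omega
    have heq := Submodule.eq_of_le_of_finrank_eq hle hfin
    have hm' : m ∈ idealDegree (Ideal.span (Set.range H)) t := by rw [heq]; exact hm
    exact hm'.1
  obtain ⟨hfinite, hcount⟩ := hbasis_finrank he H F hH hF hK (T := k * (e - 1)) htop
  refine ⟨hfinite, ?_⟩
  have hs := hsum (k * (e - 1)) le_rfl
  have hsub : ∑ t ∈ Finset.range (k * (e - 1) + 1), hilb (Ideal.span (Set.range H)) t =
      ∑ t ∈ Finset.range (k * (e - 1) + 1), finrank K (homogeneousSubmodule (Fin k) K t) -
        ∑ t ∈ Finset.range (k * (e - 1) + 1),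
          finrank K (idealDegree (Ideal.span (Set.range H)) t) := by
    simp only [hilb]
    exact Finset.sum_tsub_distrib _ fun t _ => finrank_idealDegree_le _ t
  rw [hsub] at hs
  omega

end Hilbert

/-! ## Assembly of item `stmt-ValiantsHypothesis-19256` from two remaining stubs

`MReg` (Macaulay: forms with only the trivial common zero are a regular sequence) and
`GenericRadical` (generic fibre of the finite flat map `F` is reduced) are the two pieces of memo
§4b NOT proved in this scratch file; everything else (H-basis, Hilbert count, zero-dimensional
finiteness theorem of the tree) is assembled here into the filed signature of 19256. -/

section Assembly19256

open Module

/-- Stub **M-Reg** (Macaulay; tree route: localize at the irrelevant ideal, `SopRegular`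
`isRegular_of_maximalIdeal_pow_le_ofList`, graded descent): `k ≥ 1` forms of degree `e ≥ 1` in `k`
variables with only the trivial common zero are non-zero, form a regular sequence (each a
non-zero-divisor modulo its predecessors) and have vanishing first Koszul homology. -/
def MReg : Prop :=
  ∀ (k e : ℕ), 1 ≤ k → 1 ≤ e → ∀ H : Fin k → MvPolynomial (Fin k) ℂ,
    (∀ i, (H i).IsHomogeneous e) →
    (∀ ξ : Fin k → ℂ, (∀ i, eval ξ (H i) = 0) → ξ = 0) →
    (∀ i, H i ≠ 0) ∧
    (∀ j : Fin k, ∀ f, H j * f ∈ prefixIdeal H j → f ∈ prefixIdeal H j) ∧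
    Literature.RingTheory.Koszul.HasKoszulSyzygies H

/-- Stub **GenericRadical** (generic reducedness of the fibres of `F = H + lower`, `H` as in
`MReg`'s conclusion; route: `S` is free of rank `e^k` over `ℂ[F]` by `finrank_quotient_eq_pow`,
the discriminant of its trace form is a non-zero polynomial (separability in characteristic `0`),
and a fibre over a point where it does not vanish has non-degenerate trace form, hence is
reduced). -/
def GenericRadical : Prop :=
  ∀ (k e : ℕ), 1 ≤ k → 1 ≤ e → ∀ H F : Fin k → MvPolynomial (Fin k) ℂ,
    (∀ i, (H i).IsHomogeneous e) → (∀ i, (F i - H i).totalDegree < e) →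
    (∀ i, H i ≠ 0) →
    (∀ j : Fin k, ∀ f, H j * f ∈ prefixIdeal H j → f ∈ prefixIdeal H j) →
    Literature.RingTheory.Koszul.HasKoszulSyzygies H →
    ∃ c : Fin k → ℂ, (Ideal.span (Set.range fun i => F i - C (c i))).IsRadical

omit [Fintype ι] in
/-- `deg ∂ᵢ p ≤ deg p − 1`. -/
theorem totalDegree_pderiv_le {p : MvPolynomial σ K} (i : σ) :
    (pderiv i p).totalDegree ≤ p.totalDegree - 1 := by
  classical
  conv_lhs => rw [← sum_homogeneousComponent p]
  rw [map_sum]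
  refine (totalDegree_finsetSum _ _).trans (Finset.sup_le fun n hn => ?_)
  have h := ((homogeneousComponent_isHomogeneous n p).pderiv (i := i)).totalDegree_le
  have hn' := Finset.mem_range.1 hn
  omega

/-- **Assembly**: `MReg → GenericRadical → item 19256` (the conclusion is the signature of
`BarrierLever.GradientGenericFibreCount`, stmt-ValiantsHypothesis-19256, verbatim). -/
theorem item19256_of (hReg : MReg) (hRad : GenericRadical) :
    ∀ k d : ℕ, 3 ≤ d → ∀ g : MvPolynomial (Fin k) ℂ, g.totalDegree ≤ d →
      (∀ ξ : Fin k → ℂ, (∀ i, MvPolynomial.eval ξ (MvPolynomial.pderiv i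
        (MvPolynomial.homogeneousComponent d g)) = 0) → ξ = 0) →
      ∃ c : Fin k → ℂ, {x : Fin k → ℂ | ∀ i, MvPolynomial.eval x (MvPolynomial.pderiv i g) = c i}.Finite ∧
        (d - 1) ^ k ≤ {x : Fin k → ℂ | ∀ i, MvPolynomial.eval x (MvPolynomial.pderiv i g) = c i}.ncard := by
  intro k d hd g hg hns
  rcases Nat.eq_zero_or_pos k with rfl | hk
  · refine ⟨fun _ => 0, Set.toFinite _, ?_⟩
    have huniv : {x : Fin 0 → ℂ | ∀ i : Fin 0, MvPolynomial.eval x (MvPolynomial.pderiv i g) =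
        (fun _ => (0 : ℂ)) i} = Set.univ := Set.eq_univ_of_forall fun x i => i.elim0
    rw [huniv, Set.ncard_univ, pow_zero]
    simp
  -- `k ≥ 1`
  set e := d - 1 with he_def
  have he : 1 ≤ e := by omega
  set H : Fin k → MvPolynomial (Fin k) ℂ := fun i => pderiv i (homogeneousComponent d g) with hH_def
  have hH : ∀ i, (H i).IsHomogeneous e := fun i =>
    (homogeneousComponent_isHomogeneous d g).pderiv
  obtain ⟨hH0, hnzd, hK⟩ := hReg k e hk he H hH hns
  set F₀ : Fin k → MvPolynomial (Fin k) ℂ := fun i => pderiv i g with hF₀_def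
  have hlow : (g - homogeneousComponent d g).totalDegree ≤ d - 1 := by
    by_cases h0 : g - homogeneousComponent d g = 0
    · rw [h0, totalDegree_zero]; omega
    · have hle : (g - homogeneousComponent d g).totalDegree ≤ d :=
        (totalDegree_sub _ _).trans
          (max_le hg (homogeneousComponent_isHomogeneous d g).totalDegree_le)
      have htop : homogeneousComponent d (g - homogeneousComponent d g) = 0 := by
        rw [map_sub, homogeneousComponent_eq_self (homogeneousComponent_isHomogeneous d g),
          sub_self]
      have := totalDegree_lt_of_homogeneousComponent_eq_zero h0 hle htop
      omega
  have hF₀ : ∀ i, (F₀ i - H i).totalDegree < e := by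
    intro i
    have h1 : F₀ i - H i = pderiv i (g - homogeneousComponent d g) := by
      simp only [hF₀_def, hH_def, map_sub]
    rw [h1]
    have := totalDegree_pderiv_le (p := g - homogeneousComponent d g) i
    omega
  obtain ⟨c, hrad⟩ := hRad k e hk he H F₀ hH hF₀ hH0 hnzd hK
  set Fc : Fin k → MvPolynomial (Fin k) ℂ := fun i => F₀ i - C (c i) with hFc_def
  have hFc : ∀ i, (Fc i - H i).totalDegree < e := by
    intro i
    have h1 : Fc i - H i = (F₀ i - H i) - C (c i) := by simp only [hFc_def]; ring
    rw [h1]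
    refine (totalDegree_sub _ _).trans_lt (max_lt (hF₀ i) ?_)
    rw [totalDegree_C]; omega
  obtain ⟨hfin, hrank⟩ := finrank_quotient_eq_pow hk he H Fc hH hFc hH0 hnzd hK
  haveI := hfin
  have hcard := (Literature.RingTheory.ZeroDimensional.FinitenessTheorem.finrank_eq_ncard_zeroLocus_iff_isRadical
    (K := ℂ) (I := Ideal.span (Set.range Fc))).2 hrad
  have hfinite := Literature.RingTheory.ZeroDimensional.FinitenessTheorem.finite_zeroLocus
    (K := ℂ) (I := Ideal.span (Set.range Fc))
  have hset : MvPolynomial.zeroLocus ℂ (Ideal.span (Set.range Fc)) =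
      {x : Fin k → ℂ | ∀ i, MvPolynomial.eval x (MvPolynomial.pderiv i g) = c i} := by
    rw [MvPolynomial.zeroLocus_span]
    ext x
    simp only [Set.mem_setOf_eq, Set.forall_mem_range]
    refine forall_congr' fun i => ?_
    have hev : ∀ p : MvPolynomial (Fin k) ℂ, aeval x p = eval x p := fun p => rfl
    rw [hev]
    simp only [hFc_def, hF₀_def, map_sub, eval_C]
    exact sub_eq_zero
  refine ⟨c, hset ▸ hfinite, ?_⟩
  rw [← hset, ← hcard, hrank]

end Assembly19256

end Summit.ValiantsHypothesis.ValiantsHypothesis.Theorems.BarrierLever.HBasis
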